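import Mathlib
import Summits.Ventures.PercRepro2.TB14Series

/-!
# The edge between the two marks never hurts (typed BHK 1.4): the mark–mark edge deletes
(blind cell PercRepro2, mine-c g18, 2026-08-25; `proofs/MINEC-TB14BLOCK.md` §12.8, Theorem P)

Let `e = b o` be a free edge joining the two marks.  Splitting the two-copy sum of the folded kernel
`foldK = 1_Q(y) 1_Q(w) 1[b ∈ C_y(a₁)] (1[o ∈ C_w(a₂)] − 1[o ∈ C_y(a₂)])` on `e` gives, for every
admissible configuration `y₂` of the profile with `e` closed (second copy `w₂`), the three summands
`foldK (y₂[e ↦ 1]) w₂` (`e` open in the first copy), `foldK y₂ (w₂[e ↦ 1])` (open in the second) and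
`foldK y₂ w₂` (closed in both, i.e. the instance `G − e`).  The DEFECT
`foldK (y₂[e ↦ 1]) w₂ + foldK y₂ (w₂[e ↦ 1]) − foldK y₂ w₂` is POINTWISE nonnegative
(`markEdgeDefect_nonneg`): every connection in the configuration with `e` opened is a connection of
the old one or goes through the new edge (`conn_update_true_iff`), which turns the three summands
into products of indicators of ten connection events of `(y₂, w₂)`, and the inequality into a finite
Boolean check (`markEdge_key`) using only the transitivity of connections.  Hence
(`pairCount_foldK_markEdge`, `pairCount_foldK_le_markEdge`)

  `D(G; a₁, a₂, b, o) = D(G − bo; a₁, a₂, b, o) + (a nonnegative count)  ≥  D(G − bo; a₁, a₂, b, o)`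

at every profile in which `bo` is free: the edge between the marks can be deleted in an induction
on the edges, and the core of row 2′TB has `b ≁ o`.  Exact check `data/mine-c/g18/scripts/ptwise.c`
(pointwise, all colourings of all graphs with n ≤ 7 (m ≤ 10), 0 negatives).  Own work; standard axioms.
-/

namespace Summit.Ventures.PercRepro2

namespace TB14Cut

open CovForm A3InactiveTyped

section MarkEdge

variable {V : Type} {E : Type} [Fintype E] [DecidableEq E] {R : Type*} [Field R]

omit [Fintype E] in
/-- **Opening one edge**: a connection in `y[e ↦ 1]` is a connection of `y` or passes through the
new edge `e = p q`. -/
lemma conn_update_true_iff {ends : E → Sym2 V} {y : Config E} {e : E} {p q : V}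
    (he : ends e = s(p, q)) (hy : y e = false) (s t : V) :
    Conn ends (Function.update y e true) s t ↔
      Conn ends y s t ∨ (Conn ends y s p ∧ Conn ends y q t) ∨ (Conn ends y s q ∧ Conn ends y p t) := by
  set y' := Function.update y e true with hy'
  have hle : y ≤ y' := by
    intro f
    by_cases hf : f = e
    · subst hf; simp [hy', hy]
    · simp [hy', Function.update_of_ne hf]
  have hpq : Conn ends y' p q := conn_of_openAdj ⟨e, by simp [hy'], he⟩
  constructor
  · intro hc
    have key : t ∈ {u | Conn ends y s u ∨ (Conn ends y s p ∧ Conn ends y q u) ∨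
        (Conn ends y s q ∧ Conn ends y p u)} := by
      refine mem_of_conn_of_closed (S := {u | Conn ends y s u ∨ (Conn ends y s p ∧ Conn ends y q u) ∨
        (Conn ends y s q ∧ Conn ends y p u)}) ?_ (Or.inl (conn_refl _ _ _)) hc
      intro u hu u' huu'
      obtain ⟨_, f, hf, hends⟩ := openGraph_adj.1 huu'
      by_cases hfe : f = e
      · subst hfe
        rw [he, Sym2.eq_iff] at hends
        rcases hends with ⟨rfl, rfl⟩ | ⟨rfl, rfl⟩
        · -- `u = p`, `u' = q`
          rcases hu with hu | ⟨hsp, _⟩ | ⟨hsq, _⟩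
          · exact Or.inr (Or.inl ⟨hu, conn_refl _ _ _⟩)
          · exact Or.inr (Or.inl ⟨hsp, conn_refl _ _ _⟩)
          · exact Or.inl hsq
        · -- `u = q`, `u' = p`
          rcases hu with hu | ⟨hsp, _⟩ | ⟨hsq, _⟩
          · exact Or.inr (Or.inr ⟨hu, conn_refl _ _ _⟩)
          · exact Or.inl hsp
          · exact Or.inr (Or.inr ⟨hsq, conn_refl _ _ _⟩)
      · have hf' : y f = true := by
          rw [hy', Function.update_of_ne hfe] at hf; exact hf
        have hadj : Conn ends y u u' := conn_of_openAdj ⟨f, hf', hends⟩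
        rcases hu with hu | ⟨hsp, hqu⟩ | ⟨hsq, hpu⟩
        · exact Or.inl (conn_trans hu hadj)
        · exact Or.inr (Or.inl ⟨hsp, conn_trans hqu hadj⟩)
        · exact Or.inr (Or.inr ⟨hsq, conn_trans hpu hadj⟩)
    exact key
  · rintro (h | ⟨hsp, hqt⟩ | ⟨hsq, hpt⟩)
    · exact conn_mono hle h
    · exact conn_trans (conn_trans (conn_mono hle hsp) hpq) (conn_mono hle hqt)
    · exact conn_trans (conn_trans (conn_mono hle hsq) (conn_symm hpq)) (conn_mono hle hpt)

omit [Fintype E] [DecidableEq E] in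
/-- The Boolean core of Theorem P: the defect of the mark–mark edge, written in the ten connection
events of the closed-edge configuration pair, is nonnegative given the transitivity of connections.
`A1 = a₁ ↔_y a₂`, `A2 = a₁ ↔_w a₂`, `A3 = a₁ ↔_y b`, `A4 = a₁ ↔_y o`, `A5 = a₂ ↔_y b`, `A6 = a₂ ↔_y o`,
`A7 = a₂ ↔_w b`, `A8 = a₂ ↔_w o`, `A9 = a₁ ↔_w b`, `A10 = a₁ ↔_w o`. -/
lemma markEdge_key [LinearOrder R] [IsStrictOrderedRing R]
    (A1 A2 A3 A4 A5 A6 A7 A8 A9 A10 : Prop) [Decidable A1] [Decidable A2] [Decidable A3]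
    [Decidable A4] [Decidable A5] [Decidable A6] [Decidable A7] [Decidable A8] [Decidable A9]
    [Decidable A10] (h35 : A3 → A5 → A1) (h46 : A4 → A6 → A1) (h97 : A9 → A7 → A2)
    (h108 : A10 → A8 → A2) :
    (0 : R) ≤
      (if A1 ∨ (A3 ∧ A6) ∨ (A4 ∧ A5) then 0 else 1) * (if A2 then 0 else 1) *
          (if A3 ∨ A4 then 1 else 0) * ((if A8 then 1 else 0) - (if A6 ∨ A5 then 1 else 0)) +
        (if A1 then 0 else 1) * (if A2 ∨ (A9 ∧ A8) ∨ (A10 ∧ A7) then 0 else 1) *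
          (if A3 then 1 else 0) * ((if A8 ∨ A7 then 1 else 0) - (if A6 then 1 else 0)) -
        (if A1 then 0 else 1) * (if A2 then 0 else 1) * (if A3 then 1 else 0) *
          ((if A8 then 1 else 0) - (if A6 then 1 else 0)) := by
  by_cases hA1 : A1
  · simp [hA1]
  by_cases hA2 : A2
  · simp [hA2]
  by_cases hA3 : A3
  · have hA5 : ¬ A5 := fun h => hA1 (h35 hA3 h)
    split_ifs <;> simp_all
  · by_cases hA4 : A4
    · have hA6 : ¬ A6 := fun h => hA1 (h46 hA4 h)
      split_ifs <;> simp_all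
    · simp [hA1, hA2, hA3, hA4]

variable {ends : E → Sym2 V} {e : E} {a₁ a₂ b o : V}

/-- The defect of opening the mark–mark edge `e` at the profile in which it is closed: the two
summands with `e` open in one copy minus the summand with `e` closed in both. -/
noncomputable def markEdgeDefect (ends : E → Sym2 V) (e : E) (a₁ a₂ b o : V) :
    Config E → Config E → R :=
  fun y₂ w₂ => foldK ends a₁ a₂ b o (Function.update y₂ e true) w₂ +
    foldK ends a₁ a₂ b o y₂ (Function.update w₂ e true) - foldK ends a₁ a₂ b o y₂ w₂

omit [Fintype E] in
/-- **The defect of the mark–mark edge is pointwise nonnegative** (the heart of Theorem P). -/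
lemma markEdgeDefect_nonneg [LinearOrder R] [IsStrictOrderedRing R] (he : ends e = s(b, o))
    (y₂ w₂ : Config E) (hy : y₂ e = false) (hw : w₂ e = false) :
    (0 : R) ≤ markEdgeDefect ends e a₁ a₂ b o y₂ w₂ := by
  classical
  -- the connections of the opened configurations in terms of the closed ones
  have hy' := conn_update_true_iff (ends := ends) he hy
  have hw' := conn_update_true_iff (ends := ends) he hw
  have hQy' : Conn ends (Function.update y₂ e true) a₁ a₂ ↔
      Conn ends y₂ a₁ a₂ ∨ (Conn ends y₂ a₁ b ∧ Conn ends y₂ a₂ o) ∨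
        (Conn ends y₂ a₁ o ∧ Conn ends y₂ a₂ b) := by
    rw [hy' a₁ a₂]
    constructor
    · rintro (h | ⟨h1, h2⟩ | ⟨h1, h2⟩)
      · exact Or.inl h
      · exact Or.inr (Or.inl ⟨h1, conn_symm h2⟩)
      · exact Or.inr (Or.inr ⟨h1, conn_symm h2⟩)
    · rintro (h | ⟨h1, h2⟩ | ⟨h1, h2⟩)
      · exact Or.inl h
      · exact Or.inr (Or.inl ⟨h1, conn_symm h2⟩)
      · exact Or.inr (Or.inr ⟨h1, conn_symm h2⟩)
  have hLy' : Conn ends (Function.update y₂ e true) a₁ b ↔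
      Conn ends y₂ a₁ b ∨ Conn ends y₂ a₁ o := by
    rw [hy' a₁ b]
    constructor
    · rintro (h | ⟨h1, _⟩ | ⟨h1, _⟩)
      · exact Or.inl h
      · exact Or.inl h1
      · exact Or.inr h1
    · rintro (h | h)
      · exact Or.inl h
      · exact Or.inr (Or.inr ⟨h, conn_refl _ _ _⟩)
  have hHy' : Conn ends (Function.update y₂ e true) a₂ o ↔
      Conn ends y₂ a₂ o ∨ Conn ends y₂ a₂ b := by
    rw [hy' a₂ o]
    constructor
    · rintro (h | ⟨h1, _⟩ | ⟨h1, _⟩)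
      · exact Or.inl h
      · exact Or.inr h1
      · exact Or.inl h1
    · rintro (h | h)
      · exact Or.inl h
      · exact Or.inr (Or.inl ⟨h, conn_refl _ _ _⟩)
  have hQw' : Conn ends (Function.update w₂ e true) a₁ a₂ ↔
      Conn ends w₂ a₁ a₂ ∨ (Conn ends w₂ a₁ b ∧ Conn ends w₂ a₂ o) ∨
        (Conn ends w₂ a₁ o ∧ Conn ends w₂ a₂ b) := by
    rw [hw' a₁ a₂]
    constructor
    · rintro (h | ⟨h1, h2⟩ | ⟨h1, h2⟩)
      · exact Or.inl h
      · exact Or.inr (Or.inl ⟨h1, conn_symm h2⟩)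
      · exact Or.inr (Or.inr ⟨h1, conn_symm h2⟩)
    · rintro (h | ⟨h1, h2⟩ | ⟨h1, h2⟩)
      · exact Or.inl h
      · exact Or.inr (Or.inl ⟨h1, conn_symm h2⟩)
      · exact Or.inr (Or.inr ⟨h1, conn_symm h2⟩)
  have hHw' : Conn ends (Function.update w₂ e true) a₂ o ↔
      Conn ends w₂ a₂ o ∨ Conn ends w₂ a₂ b := by
    rw [hw' a₂ o]
    constructor
    · rintro (h | ⟨h1, _⟩ | ⟨h1, _⟩)
      · exact Or.inl h
      · exact Or.inr h1
      · exact Or.inl h1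
    · rintro (h | h)
      · exact Or.inl h
      · exact Or.inr (Or.inl ⟨h, conn_refl _ _ _⟩)
  simp only [markEdgeDefect, foldK, iQ_eq_ite', iL_eq_ite', iH_eq_ite', hQy', hLy', hHy', hQw',
    hHw']
  exact markEdge_key (Conn ends y₂ a₁ a₂) (Conn ends w₂ a₁ a₂) (Conn ends y₂ a₁ b)
    (Conn ends y₂ a₁ o) (Conn ends y₂ a₂ b) (Conn ends y₂ a₂ o) (Conn ends w₂ a₂ b)
    (Conn ends w₂ a₂ o) (Conn ends w₂ a₁ b) (Conn ends w₂ a₁ o)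
    (fun h h' => conn_trans h (conn_symm h')) (fun h h' => conn_trans h (conn_symm h'))
    (fun h h' => conn_trans h (conn_symm h')) (fun h h' => conn_trans h (conn_symm h'))

/-- **Splitting on the mark–mark edge**: the two-copy count at a profile in which `e` is free is the
count with `e` closed plus the count of the defect kernel. -/
theorem pairCount_foldK_markEdge (F : Finset E) (z : Config E) (heF : e ∈ F) :
    pairCount F z (foldK ends a₁ a₂ b o : Config E → Config E → R) =
      pairCount (F.erase e) (Function.update z e false) (foldK ends a₁ a₂ b o) +
        pairCount (F.erase e) (Function.update z e false) (markEdgeDefect ends e a₁ a₂ b o) := by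
  classical
  unfold pairCount
  rw [sum_admissible_split heF, ← Finset.sum_add_distrib]
  refine Finset.sum_congr rfl fun y₂ _ => ?_
  by_cases hadm : ∀ f, f ∉ F.erase e → y₂ f = Function.update z e false f
  · rw [if_pos hadm, if_pos hadm, if_pos hadm]
    have hy₂ : y₂ e = false := by
      have := hadm e (Finset.notMem_erase e F)
      rwa [Function.update_self] at this
    have hself : Function.update y₂ e false = y₂ := by
      rw [← hy₂]; exact Function.update_eq_self e y₂
    have hflip₀ : A3InactiveTyped.flipOn F y₂ =
        Function.update (A3InactiveTyped.flipOn (F.erase e) y₂) e true := by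
      funext f
      by_cases hf : f = e
      · subst hf
        rw [A3InactiveTyped.flipOn_of_mem heF, hy₂, Function.update_self]; rfl
      · rw [Function.update_of_ne hf]
        by_cases hfF : f ∈ F
        · rw [A3InactiveTyped.flipOn_of_mem hfF,
            A3InactiveTyped.flipOn_of_mem (Finset.mem_erase.2 ⟨hf, hfF⟩)]
        · rw [A3InactiveTyped.flipOn_of_notMem hfF,
            A3InactiveTyped.flipOn_of_notMem (fun h => hfF (Finset.mem_of_mem_erase h))]
    have hflip₁ : A3InactiveTyped.flipOn F (Function.update y₂ e true) =
        A3InactiveTyped.flipOn (F.erase e) y₂ := by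
      funext f
      by_cases hf : f = e
      · subst hf
        rw [A3InactiveTyped.flipOn_of_mem heF, Function.update_self,
          A3InactiveTyped.flipOn_of_notMem (Finset.notMem_erase f F)]
        exact hy₂.symm
      · by_cases hfF : f ∈ F
        · rw [A3InactiveTyped.flipOn_of_mem hfF,
            A3InactiveTyped.flipOn_of_mem (Finset.mem_erase.2 ⟨hf, hfF⟩), Function.update_of_ne hf]
        · rw [A3InactiveTyped.flipOn_of_notMem hfF,
            A3InactiveTyped.flipOn_of_notMem (fun h => hfF (Finset.mem_of_mem_erase h)),
            Function.update_of_ne hf]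
    rw [hself, hflip₀, hflip₁]
    simp only [markEdgeDefect]
    ring
  · rw [if_neg hadm, if_neg hadm, if_neg hadm, add_zero]

/-- **THEOREM P — the mark–mark edge never hurts**: closing (deleting) a free edge between the two
marks does not increase the two-copy count of the folded kernel,
`D(G − bo) ≤ D(G)`, at every profile in which `bo` is free. -/
theorem pairCount_foldK_le_markEdge [LinearOrder R] [IsStrictOrderedRing R] (he : ends e = s(b, o))
    (F : Finset E) (z : Config E) (heF : e ∈ F) :
    pairCount (F.erase e) (Function.update z e false)
        (foldK ends a₁ a₂ b o : Config E → Config E → R) ≤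
      pairCount F z (foldK ends a₁ a₂ b o) := by
  classical
  rw [pairCount_foldK_markEdge F z heF]
  refine le_add_of_nonneg_right ?_
  unfold pairCount
  refine Finset.sum_nonneg fun y₂ _ => ?_
  split_ifs with hadm
  · have hy₂ : y₂ e = false := by
      have := hadm e (Finset.notMem_erase e F)
      rwa [Function.update_self] at this
    have hw₂ : A3InactiveTyped.flipOn (F.erase e) y₂ e = false := by
      rw [A3InactiveTyped.flipOn_of_notMem (Finset.notMem_erase e F)]; exact hy₂
    exact markEdgeDefect_nonneg he y₂ _ hy₂ hw₂
  · exact le_rfl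

end MarkEdge

end TB14Cut

end Summit.Ventures.PercRepro2
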